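/-
Copyright (c) 2026 the pub-hodgecm-mathlib formalisation cell (harness21).  Prover seats hodgecm-mathlib-LA1-p04 (g3) (drafter of ★ `RoofLegsSpecialFibreKernelRows`; organ #3-bis's
author of record is LA3-p01) and A-p06 (g36) (THIS image edition: + the IMAGE ∕ FACTORISATION row (IMG-gen) of the reduced leg, L2 organ (IMG), LA2-plan (g2) rulings
2026-09-02T08:56:42Z (IMG-T) and 09:34:45Z «(d) in W1's (K3-gen) row currency»); «GO 500» half A; 2026-09-02.
-/
import Literature.AlgebraicGeometry.AbelianSchemes.RoofLegsSpecialFibreThroughBase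
import Literature.AlgebraicGeometry.AbelianSchemes.AbelianSchemeHomReductionSpecialFibreKernelRowsImage   -- the image head (A-p06 (g36) p850853)
import Literature.AlgebraicGeometry.AbelianSchemes.AbelianSchemeFibreBaseChangeHom                          -- §0: naturality of `fibreBaseChangeIso` in the abelian scheme
import Literature.AlgebraicGeometry.AbelianSchemes.AbelianSchemeFibreFrobeniusTwistHom                     -- §0: naturality of `fibreCongrPtIso`
import Literature.AlgebraicGeometry.GroupSchemes.EtaleKernelDecidedOnPoints
import HarnessLib

/-!
# The legs of the downstairs roof THROUGH `𝒜`, WITH THE KERNEL ROWS OF THE REDUCED LEG: `q̄` kills every flat model subscheme `q` kills (K3),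
# `Ker q(Ω̄) ⊆ 𝒜_x[𝔞](Ω̄) ⇒ Ker q̄ ⊆ 𝒜_{x̄}[𝔞]` on all `T`-points (K2), AND THE IMAGE ROW (IMG-gen): `q(𝒦_η) ⊆ c(𝒵_η) ⇒ q̄(𝒦_s̄) ⊆ c̄(𝒵_s̄)` — IMAGE EDITION
# ([SerreTate1968] §1 Lemma 2; [Liu2021] Prop. D.8; [BoschLutkebohmertRaynaud1990] §2.5 Prop. 2)

Topic `AlgebraicGeometry/AbelianSchemes`, namespace `Literature.AlgebraicGeometry.AbelianSchemes.AbelianSchemeOver`.  THEOREMS ONLY (no definition, no named fact,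
no `instance`, no notation, no `sorry`).  Cell `hodgecm-mathlib` (D-0151), F0∕P6 «MOD», «GO 500» half A line L3 (socket `stub_FROB` of the D-line
`Cruxes/HLiu418/Lines/F0_P6a_DatumOfInputs.lean`, road ROOF → `stub_ROOF0`), RULING (γ1) «ONE ∃, ONE ROOF DOWNSTAIRS»: the reduced leg `q̄` of the ROOF-LEGS leaflet is ONE
∃-witness, so every kernel fact about it must be exported as a ROW by the producing organ.  This file is ★ organ #3-bis `exists_roofLeg_specialFibre_of_downstairsDual`
(p849660) VERBATIM — same binders, same rows (r1₀) (r4₀-q) (r5₀-q) (r3₀-q), same proof — with the ONE reduction call re-pointed from ★ (ν8h)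
`exists_specialFibre_hom_reduction_comp` to ★ `exists_specialFibre_hom_reduction_kerRows` (the same rows plus the kernel rows), and TWO extra exported rows for THE SAME
`q̄`: **(K3-gen)** for every flat `𝒦 ↪ 𝒜_x̃` over the valuation ring `R = 𝒪_Ω̄` (`x̃ := extendPoint …` the `R`-point extending `x`; three-piece isomorphisms of ★ (d5) written
explicitly, as ★ (ν8R)): if the leg `q : 𝒜_x → B` kills `𝒦_η` then `q̄` kills `𝒦_s` (the head's row is for `q′ = q ≫ E⁻¹`; `E` is an isomorphism); **(K2-gen)** for every
ideal `𝔞` of `𝒪`: if every `Ω̄`-POINT of `𝒜_x` killed by `q` is killed by `ι(𝔞)`, then every `T`-valued point of `𝒜_{x̄}` killed by `q̄` is killed by `ι(𝔞)` (the head's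
row (K2) wants the premiss on all `T`-points upstairs; `q′` is an isogeny over `Ω̄` of characteristic `0`, so ★ `comp_eq_one_of_forall_points_of_charZero` upgrades the
`Ω̄`-points premiss).

WHY ([Liu2021] Prop. D.8 p. 135, pp. 136–138; LA3-plan (g2) (hker-DOWN)∕(K-ROWS)): the block-law assembly at `x̄` (★ `FrobeniusKernelLawBlockAssembly`, `hker`) needs
`Ker q̄ ⊆ 𝒜_{x̄}[𝔭_w·𝔭_{c•w}]`; upstairs `Ker q = K ⊆ 𝒜_y[𝔭_w·𝔭_{c•w}]` on `Ω̄`-points is the support clause of the Hecke translate (L2's ★ `isIdealTorsion_mul_of_roof`), and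
(K2-gen) at `𝔞 := 𝔭_w·𝔭_{c•w}` carries it downstairs; (K3-gen) serves the (ρ1)-rebased `spGeoOf` kernel reading at `𝒦 :=` the saturated closure of a line.
Consumer: the ROOF-LEGS leaflet ED. 2 (LA3-p01), which switches its call of #3-bis to this head BY NAME.

IMAGE EDITION (this file, A-p06 (g36)): = ★ `RoofLegsSpecialFibreKernelRows` BY COPY (binders, rows (r1₀)(r4₀-q)(r5₀-q)(r3₀-q)(K3-gen)(K2-gen) and their proofs
byte-identical), head renamed **`exists_roofLeg_specialFibre_of_downstairsDual_kerRows_image`**, the ONE reduction call re-pointed to the image head ★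
`exists_specialFibre_hom_reduction_kerRows_image` (same rows + (v-c)), and ONE more exported row, LAST, for THE SAME `q̄`: **(IMG-gen) IMAGE ∕ FACTORISATION in ROOF
currency** — for a flat `incl : 𝒦 → 𝒜_x̃` and a model subscheme `ζ : 𝒵 → 𝒜_x̃″` (`x̃″` the `R`-point extending `x″`) whose composite with the model cover leg
`c̄_R = ψ_P ×_𝓨 x̃″ : 𝒜_x̃″ → 𝒞_x̃″` is a CLOSED immersion: if the LEG `q` carries `𝒦_η` (read in `(𝒜_η)_x` through the three-piece isomorphism) INTO `c(𝒵_η)` (`𝒵_η` read in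
`(𝒜_η)_{x″}` through the three-piece isomorphism at `x″`, then the LEG `c`), then `q̄` carries `𝒦_s̄` into `c̄_{x̄″}(𝒵_s̄)` — both sides factorisations of morphisms, the
three-piece isomorphisms of `𝒜` at `x` and at `x″` explicit, NO isomorphism of the middle: ★ organ #2's recognition `E : 𝒞_{x″} ≅ B` (`c̄_{x″} ≫ E = c`) is internal, and §0
(naturality of the three-piece isomorphism in the abelian scheme, for `ψ_P : 𝒜 → 𝒞`) moves the model cover leg `c̄_R` through it; so the row is the head's (v-c) for
`q′ = q ≫ E⁻¹` at `ζ ≫ c̄_R`, read back through `E` upstairs ([BoschLutkebohmertRaynaud1990] §2.5 Prop. 2; [GortzWedhorn2020] Prop. 9.19, Rem. 9.20, Section (4.7)).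
Consumer: (ρ1𝒞) v3's (IMG) row (LA1-p01 (g3); L2 LA2-plan (g2) 09:34:45Z) at `𝒦 :=` the dock's torsion model, `𝒵 :=` the saturated quotient `Spec (Alg G ⧸ J″^sat) → G → 𝒜_x̃″`.

HONEST LABEL: HC_CM is proved only modulo the cell's 2 remaining named inputs (hLiu418 24832, h413 24833) until rung 0 closes; generic capital on
`--supports stmt-HodgeConjecture-24832`, pays no letter.

## References
* [SerreTate1968] J.-P. Serre, J. Tate, *Good reduction of abelian varieties*, Ann. of Math. 88 (1968), §1 (Lemma 2, Theorem 1).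
* [BoschLutkebohmertRaynaud1990] S. Bosch, W. Lütkebohmert, M. Raynaud, *Néron Models* (1990), §1.2 Prop. 8, §7.1 Lemma 5 ∕ Prop. 6, §7.3 Prop. 6 (p. 180).
* [MumfordAV1970] D. Mumford, *Abelian Varieties* (1970), §7 Thm. 4 (p. 72), §15 Thm. 1 (p. 143), §23 Thm. 2 (p. 231).
* [Conrad2004GrossZagier] B. Conrad, *Gross–Zagier revisited*, MSRI Publ. 49 (2004), §7 (Thm. 7.5).
* [Liu2021] Y. Liu, *Fourier–Jacobi cycles and arithmetic relative trace formula*, Camb. J. Math. 9 (2021), Appendix D, Prop. D.8 (p. 135), pp. 136–138.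
* [GortzWedhorn2020] U. Görtz, T. Wedhorn, *Algebraic Geometry I*, 2nd ed. (2020), Definition 4.45 (2) (p. 117); Section (4.7) (p. 135); Prop. 9.19, Rem. 9.20.
* [BoschLutkebohmertRaynaud1990] (bis) §2.5 Prop. 2 (schematic closure of the generic fibre in a flat `R`-scheme).
* [MumfordFogartyKirwan1994] D. Mumford, J. Fogarty, F. Kirwan, *GIT*, 3rd ed., Ch. 7 §2 Definition 7.2 (p. 129).
-/

set_option autoImplicit false

noncomputable section

set_option backward.isDefEq.respectTransparency false

open CategoryTheory CategoryTheory.Limits AlgebraicGeometry MonoidalCategory CartesianMonoidalCategory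
open scoped MonObj CategoryTheory.Obj NumberField
open Literature.AlgebraicGeometry.Motives
open IsDedekindDomain IsDedekindDomain.HeightOneSpectrum ValuativeRel
open Literature.NumberTheory.EllipticCurves (genericFibre specGenericPoint)
open Literature.NumberTheory.GaloisRepresentations (closureValuationSubring)
open Literature.NumberTheory.DiophantineGeometry

namespace Literature.AlgebraicGeometry.AbelianSchemes

namespace AbelianSchemeOver

universe u

section ThreePieceNaturality

/-! ### §0 The three-piece fibre isomorphism is natural in the abelian scheme (A-p06 (g36)) -/

variable {S B T : Scheme.{u}} {𝒜 𝒞 : AbelianSchemeOver S} (f : 𝒜.X ⟶ 𝒞.X) [IsMonHom f]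
  (b₀ : B ⟶ S) {Ω : Type u} [Field Ω] (xpt : Spec (.of Ω) ⟶ B) (xR : T ⟶ S) (ptR : Spec (.of Ω) ⟶ T) (h : xpt ≫ b₀ = ptR ≫ xR)

/-- **The three-piece fibre isomorphism `(𝒜 ×_S B)_{x} ≅ 𝒜_{x ≫ b₀} = 𝒜_{pt ≫ x_R} ≅ (𝒜 ×_S T)_{pt}` is natural in the abelian scheme.**  For a homomorphism
`f : 𝒜 → 𝒞` of abelian schemes over `S`, a base `b₀ : B → S` with a field point `x : Spec Ω → B`, and a second base `x_R : T → S` with a field point `pt : Spec Ω → T`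
such that `x ≫ b₀ = pt ≫ x_R`, the fibre at `pt` of the base change `f ×_S T` and the fibre at `x` of `f ×_S B`, as morphisms of `Ω`-schemes, correspond under the
inverse three-piece isomorphisms: `(f ×_S T)_{pt} ≫ e_𝒞⁻¹ = e_𝒜⁻¹ ≫ (f ×_S B)_x` (★ `fibreHom_baseChangeHom_comp_fibreBaseChangeIso_hom`, ★ `fibreHom_comp_fibreCongrPtIso_hom`,
★ `fibreHom_comp_fibreBaseChangeIso_inv`, read on underlying schemes).  Used below with `f := ψ_P` the Serre cover leg, `x_R := x̃″` and `pt ∈ {η_R, s̄_R}`.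
[cite: GortzWedhorn2020, Section (4.7) (p. 135) and Remark 16.54] [cite: MumfordFogartyKirwan1994, Ch. 7 §2 Definition 7.2 (p. 129)] -/
theorem pullback_map_baseChangeHom_comp_threePiece_inv :
    (Over.pullback ptR).map (baseChangeHom f xR) ≫ (𝒞.fibreBaseChangeIso b₀ xpt ≪≫ 𝒞.fibreCongrPtIso h ≪≫ (𝒞.fibreBaseChangeIso xR ptR).symm).inv.hom.hom.hom =
      (𝒜.fibreBaseChangeIso b₀ xpt ≪≫ 𝒜.fibreCongrPtIso h ≪≫ (𝒜.fibreBaseChangeIso xR ptR).symm).inv.hom.hom.hom ≫ baseChangeHom (baseChangeHom f b₀) xpt := by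
  haveI := isMonHom_baseChangeHom f xR
  haveI := isMonHom_baseChangeHom f b₀
  -- in the category of abelian varieties over `Ω`
  have e : fibreHom f (ptR ≫ xR) ≫ (𝒞.fibreCongrPtIso h).inv = (𝒜.fibreCongrPtIso h).inv ≫ fibreHom f (xpt ≫ b₀) := by
    rw [Iso.comp_inv_eq, Category.assoc, Iso.eq_inv_comp, fibreHom_comp_fibreCongrPtIso_hom]
  have key : fibreHom (baseChangeHom f xR) ptR ≫ (𝒞.fibreBaseChangeIso b₀ xpt ≪≫ 𝒞.fibreCongrPtIso h ≪≫ (𝒞.fibreBaseChangeIso xR ptR).symm).inv =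
      (𝒜.fibreBaseChangeIso b₀ xpt ≪≫ 𝒜.fibreCongrPtIso h ≪≫ (𝒜.fibreBaseChangeIso xR ptR).symm).inv ≫ fibreHom (baseChangeHom f b₀) xpt := by
    simp only [Iso.trans_inv, Iso.symm_inv, Category.assoc]
    rw [reassoc_of% (fibreHom_baseChangeHom_comp_fibreBaseChangeIso_hom xR ptR f), reassoc_of% e, fibreHom_comp_fibreBaseChangeIso_inv b₀ xpt f]
  -- read on underlying `Ω`-schemes
  have h3 := congrArg (fun φ => φ.hom.hom.hom) key
  simp only [AbelianVariety.comp_hom] at h3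
  exact h3

end ThreePieceNaturality

section Head

variable {K : Type} [Field K] [NumberField K] {v : HeightOneSpectrum (𝓞 K)} {Y : SchemeOver K}
  (𝓨 : IntegralModel (valuationSubringAtPrime K v) K Y) [IsProper 𝓨.total.hom]
  {𝒜 : AbelianSchemeOver 𝓨.total.left} {O : Type} [CommRing O] (act : 𝒜.RingAction O) [IsCommMonObj 𝒜.X]
  {m : ℕ} (E' : Matrix (Fin m) (Fin m) O) (hE' : E' * E' = E') (P : Matrix (Fin m) (Fin 1) O) (Q : Matrix (Fin 1) (Fin m) O) {N : ℕ}
  (x x'' : AlgPoints Y (AlgebraicClosure (v.adicCompletion K)))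
  (D : 𝒜.DualPair)
  (hD : Nonempty ((Scheme.Modules.pullback (DualPair.unitHatSlice D)).obj D.P ≅ SheafOfModules.unit _))
  (pol : 𝒜.Polarization D)

include hD in
set_option maxHeartbeats 800000 in
/-- **THE LEGS OF THE DOWNSTAIRS ROOF, THROUGH `𝒜`, WITH THE KERNEL ROWS (K3)(K2) AND THE IMAGE ROW (IMG-gen) OF THE REDUCED LEG — IMAGE EDITION** (★ organ #3-bis `exists_roofLeg_specialFibre_of_downstairsDual`
VERBATIM — binders and rows (r1₀)(r4₀-q)(r5₀-q)(r3₀-q) — plus two rows): from an UPSTAIRS roof `𝒜_x —q→ B ←c— 𝒜_{x″}` at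
`x, x″ ∈ Y(Ω̄)` with `q` finite surjective, `c` surjective with `Ker c(Ω̄) = 𝒜_{x″}[𝔭](Ω̄)`, a dual pair `DB` (unit pin) and a dual homomorphism `λ_B` with `q^*λ_B = N·λ_x`,
`c^*λ_B = N·λ_{x″}`, common intertwiners and matching section values, THERE IS **`q̄ : (𝒜 ×_𝓨 𝓨_s)_{x̄} → (𝒞 ×_𝓨 𝓨_s)_{x̄″}`** (`𝒞 = 𝒜 ⊗_𝒪 𝔟` the Serre family of `(E′, P, Q, N)`)
with (r1₀) flat + surjective, (r4₀-q) `ι_{x̄}(a) ≫ q̄ = q̄ ≫ ι^𝒞_{x̄″}(a)`, (r5₀-q) `q̄(τ_i(x̄)) = (τ_i ≫ ψ_P)(x̄″)`, and **(r3₀-q) FOR EVERY downstairs dual pair `DB̄` of `𝒞_{x̄″}` (unit pin)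
and every homomorphism `λ_B̄ : 𝒞_{x̄″} → B̄^` with `c̄ ≫ λ_B̄ ≫ c̄^∨ = λ_{x̄″} ≫ [N]` (`c̄ = ψ_P` at `x̄″`): `q̄ ≫ λ_B̄ ≫ q̄^∨ = λ_{x̄} ≫ [N]`.**  PROOF: ★ organ #2 (`E : 𝒞_{x″} ≅ B`
under `𝒜_{x″}`, `q′ := q ≫ E⁻¹`), ★ (ν8h) `exists_specialFibre_hom_reduction_comp` ONCE for `q′`; (r4₀)(r5₀) as ★ organ #3; (r3₀-q): `d := E⁻¹ ≫ ψ′_{x″}` has `c ≫ d = [N]`,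
`d ≫ c = [N]`, so §1 gives the law of `q′ ≫ ψ′_{x″} = q ≫ d` through `𝒜`'s polarisation with scalar `N²`, (iv-h) transfers it to `q̄ ≫ ψ′_{x̄″}`, and §1 divides downstairs
against `λ_B̄` (quasi-inverse ★ `dualIsogenyOver_coverLeg_comp_eq_pow_id`).  **KERNEL ROWS (this file)**, for THE SAME `q̄` (one call of ★
`exists_specialFibre_hom_reduction_kerRows` instead of ★ (ν8h)): (K3-gen) for every flat `𝒦 ↪ 𝒜_x̃` over `R = 𝒪_Ω̄` (`x̃` the `R`-point extending `x`), `q` kills `𝒦_η` ⇒ `q̄`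
kills `𝒦_s` (three-piece isomorphisms of ★ (d5) explicit, as ★ (ν8R)); (K2-gen) for every ideal `𝔞`, `Ker q(Ω̄) ⊆ 𝒜_x[𝔞](Ω̄)` on `Ω̄`-POINTS ⇒ `Ker q̄ ⊆ 𝒜_{x̄}[𝔞]` on ALL
`T`-points (`q′` is an isogeny in characteristic `0`, so its kernel is decided on `Ω̄`-points, ★ `comp_eq_one_of_forall_points_of_charZero`).  **IMAGE ROW (this edition; one call of
★ `exists_specialFibre_hom_reduction_kerRows_image` instead)**: (IMG-gen) for every flat `𝒦 ↪ 𝒜_x̃` and every `ζ : 𝒵 → 𝒜_x̃″` with `ζ ≫ (ψ_P ×_𝓨 x̃″)` a closed immersion,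
`incl_η ≫ e⁻¹ ≫ q` factors through `ζ_η ≫ e⁻¹ ≫ c` ⇒ `incl_s̄ ≫ e⁻¹ ≫ q̄` factors through `ζ_s̄ ≫ e⁻¹ ≫ c̄_{x̄″}` (three-piece isomorphisms `e` of `𝒜` at `x`, `x″` explicit; proof:
the head's (v-c) for `q′ = q ≫ E⁻¹` at `ζ ≫ c̄_R`, §0 naturality for `ψ_P`, and `c̄_{x″} ≫ E = c`). [cite: SerreTate1968, §1 Lemma 2] [cite: BoschLutkebohmertRaynaud1990, §2.5 Prop. 2] [cite: GortzWedhorn2020, Prop. 9.19, Rem. 9.20 and Section (4.7)] [cite: BoschLutkebohmertRaynaud1990, §1.2 Prop. 8 and §7.3 Prop. 6 (p. 180)]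
[cite: MumfordAV1970, §7 Thm. 4 (p. 72), §15 Thm. 1 (p. 143), §23 Thm. 2 (p. 231)] [cite: Conrad2004GrossZagier, §7 (Thm. 7.5)] -/
theorem exists_roofLeg_specialFibre_of_downstairsDual_kerRows_image
    (hN : N ≠ 0) (hP : E' * P = P) (hQ : Q * E' = Q)
    (hQP : Q * P = Matrix.scalar (Fin 1) (N : O)) (hPQ : P * Q = Matrix.scalar (Fin m) (N : O) * E')
    {𝔭 : Ideal O} (h𝔭 : Ideal.span (Set.range fun k => P k 0) = 𝔭)
    {J : Type*} (τ : J → 𝒜.Sections)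
    -- the upstairs roof at `x, x″`
    {B : AbelianSchemeOver (Spec (.of (AlgebraicClosure (v.adicCompletion K))))}
    (q : ((𝒜.baseChange (𝓨.genericIso'.inv.left ≫ pullback.fst 𝓨.total.hom (specGenericPoint (valuationSubringAtPrime K v) K))).baseChange x.left).X ⟶ B.X)
    [IsMonHom q] [IsFinite q.left] [Surjective q.left]
    (c : ((𝒜.baseChange (𝓨.genericIso'.inv.left ≫ pullback.fst 𝓨.total.hom (specGenericPoint (valuationSubringAtPrime K v) K))).baseChange x''.left).X ⟶ B.X)
    [IsMonHom c] [Surjective c.left]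
    -- (r2) the kernel of `c` on `Ω̄`-points is the `𝔭`-torsion
    (hker : ∀ Pt : ((𝒜.baseChange (𝓨.genericIso'.inv.left ≫ pullback.fst 𝓨.total.hom (specGenericPoint (valuationSubringAtPrime K v) K))).baseChange
        x''.left).toAffine.toAbelianVariety.Points (AlgebraicClosure (v.adicCompletion K)),
      (AlgPoints.map c Pt : B.toAffine.toAbelianVariety.Points (AlgebraicClosure (v.adicCompletion K))) = 1 ↔
        ∀ a ∈ 𝔭, (AlgPoints.map (((act.baseChange (𝓨.genericIso'.inv.left ≫ pullback.fst 𝓨.total.hom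
            (specGenericPoint (valuationSubringAtPrime K v) K))).baseChange x''.left).i a) Pt :
          ((𝒜.baseChange (𝓨.genericIso'.inv.left ≫ pullback.fst 𝓨.total.hom (specGenericPoint (valuationSubringAtPrime K v) K))).baseChange
            x''.left).toAffine.toAbelianVariety.Points (AlgebraicClosure (v.adicCompletion K))) = 1)
    -- (r3) the polarisation laws of the two legs through the dual homomorphism `λ_B`
    (DB : B.DualPair) (hDB : Nonempty ((Scheme.Modules.pullback (DualPair.unitHatSlice DB)).obj DB.P ≅ SheafOfModules.unit _))
    (lamB : B.X ⟶ DB.hat.X) [IsMonHom lamB]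
    (hq3 : q ≫ lamB ≫ DualPair.dualIsogenyOver q
        ((D.baseChange (𝓨.genericIso'.inv.left ≫ pullback.fst 𝓨.total.hom (specGenericPoint (valuationSubringAtPrime K v) K))).baseChange x.left) DB =
      ((pol.baseChange (𝓨.genericIso'.inv.left ≫ pullback.fst 𝓨.total.hom (specGenericPoint (valuationSubringAtPrime K v) K))).baseChange x.left).lam ≫
        ((D.baseChange (𝓨.genericIso'.inv.left ≫ pullback.fst 𝓨.total.hom (specGenericPoint (valuationSubringAtPrime K v) K))).baseChange x.left).hat.mulN N)
    (hc3 : c ≫ lamB ≫ DualPair.dualIsogenyOver c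
        ((D.baseChange (𝓨.genericIso'.inv.left ≫ pullback.fst 𝓨.total.hom (specGenericPoint (valuationSubringAtPrime K v) K))).baseChange x''.left) DB =
      ((pol.baseChange (𝓨.genericIso'.inv.left ≫ pullback.fst 𝓨.total.hom (specGenericPoint (valuationSubringAtPrime K v) K))).baseChange x''.left).lam ≫
        ((D.baseChange (𝓨.genericIso'.inv.left ≫ pullback.fst 𝓨.total.hom (specGenericPoint (valuationSubringAtPrime K v) K))).baseChange x''.left).hat.mulN N)
    -- (r4) common intertwiners
    (hb : ∀ a : O, ∃ b : B.X ⟶ B.X,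
      ((act.baseChange (𝓨.genericIso'.inv.left ≫ pullback.fst 𝓨.total.hom (specGenericPoint (valuationSubringAtPrime K v) K))).baseChange x.left).i a ≫ q =
          q ≫ b ∧
        ((act.baseChange (𝓨.genericIso'.inv.left ≫ pullback.fst 𝓨.total.hom (specGenericPoint (valuationSubringAtPrime K v) K))).baseChange x''.left).i a ≫ c =
          c ≫ b)
    -- (r5) level points correspond
    (hlev : ∀ i : J,
      (AlgPoints.map q ((𝒜.baseChange (𝓨.genericIso'.inv.left ≫ pullback.fst 𝓨.total.hom (specGenericPoint (valuationSubringAtPrime K v) K))).restrictPt x.left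
          (𝒜.sectionBaseChange (𝓨.genericIso'.inv.left ≫ pullback.fst 𝓨.total.hom (specGenericPoint (valuationSubringAtPrime K v) K)) (τ i))) :
          B.toAffine.toAbelianVariety.Points (AlgebraicClosure (v.adicCompletion K))) =
        AlgPoints.map c ((𝒜.baseChange (𝓨.genericIso'.inv.left ≫ pullback.fst 𝓨.total.hom (specGenericPoint (valuationSubringAtPrime K v) K))).restrictPt x''.left
          (𝒜.sectionBaseChange (𝓨.genericIso'.inv.left ≫ pullback.fst 𝓨.total.hom (specGenericPoint (valuationSubringAtPrime K v) K)) (τ i)))) :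
    ∃ (qbar : ((𝒜.baseChange (pullback.fst 𝓨.total.hom (specResidueField v))).baseChange (𝓨.geomReductionMap x).left).X ⟶
               (((serreTensor act E' hE').baseChange (pullback.fst 𝓨.total.hom (specResidueField v))).baseChange (𝓨.geomReductionMap x'').left).X)
      (_ : IsMonHom qbar),
      -- (r1₀)
      (Flat qbar.left ∧ Function.Surjective qbar.left.base) ∧
      -- (r4₀-q)
      (∀ a : O, ((act.baseChange (pullback.fst 𝓨.total.hom (specResidueField v))).baseChange (𝓨.geomReductionMap x).left).i a ≫ qbar =
        qbar ≫ (((serreAction act E' hE').baseChange (pullback.fst 𝓨.total.hom (specResidueField v))).baseChange (𝓨.geomReductionMap x'').left).i a) ∧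
      -- (r5₀-q)
      (∀ i : J,
        AlgPoints.map qbar ((𝒜.baseChange (pullback.fst 𝓨.total.hom (specResidueField v))).restrictPt (𝓨.geomReductionMap x).left
            (𝒜.sectionBaseChange (pullback.fst 𝓨.total.hom (specResidueField v)) (τ i))) =
          ((serreTensor act E' hE').baseChange (pullback.fst 𝓨.total.hom (specResidueField v))).restrictPt (𝓨.geomReductionMap x'').left
            ((serreTensor act E' hE').sectionBaseChange (pullback.fst 𝓨.total.hom (specResidueField v)) (τ i ≫ serreTranslate act E' hE' P))) ∧
      -- (r3₀-q) for ANY downstairs dual pair `DB̄` of the Serre fibre (unit pin) and dual homomorphism `λ_B̄` through which the cover leg `c̄` pulls back to `N·λ_{x̄″}`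
      (∀ (DBs : (((serreTensor act E' hE').baseChange (pullback.fst 𝓨.total.hom (specResidueField v))).baseChange (𝓨.geomReductionMap x'').left).DualPair)
        (_ : Nonempty ((Scheme.Modules.pullback (DualPair.unitHatSlice DBs)).obj DBs.P ≅ SheafOfModules.unit _))
        (lamBs : (((serreTensor act E' hE').baseChange (pullback.fst 𝓨.total.hom (specResidueField v))).baseChange (𝓨.geomReductionMap x'').left).X ⟶ DBs.hat.X) [IsMonHom lamBs],
        (haveI := isMonHom_coverLeg (pullback.fst 𝓨.total.hom (specResidueField v)) (𝓨.geomReductionMap x'').left act E' hE' P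
         baseChangeHom (baseChangeHom (serreTranslate act E' hE' P) (pullback.fst 𝓨.total.hom (specResidueField v))) (𝓨.geomReductionMap x'').left ≫ lamBs ≫
            DualPair.dualIsogenyOver (baseChangeHom (baseChangeHom (serreTranslate act E' hE' P) (pullback.fst 𝓨.total.hom (specResidueField v))) (𝓨.geomReductionMap x'').left)
              ((D.baseChange (pullback.fst 𝓨.total.hom (specResidueField v))).baseChange (𝓨.geomReductionMap x'').left) DBs =
          ((pol.baseChange (pullback.fst 𝓨.total.hom (specResidueField v))).baseChange (𝓨.geomReductionMap x'').left).lam ≫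
            ((D.baseChange (pullback.fst 𝓨.total.hom (specResidueField v))).baseChange (𝓨.geomReductionMap x'').left).hat.mulN N) →
        qbar ≫ lamBs ≫ DualPair.dualIsogenyOver qbar ((D.baseChange (pullback.fst 𝓨.total.hom (specResidueField v))).baseChange (𝓨.geomReductionMap x).left) DBs =
          ((pol.baseChange (pullback.fst 𝓨.total.hom (specResidueField v))).baseChange (𝓨.geomReductionMap x).left).lam ≫
            ((D.baseChange (pullback.fst 𝓨.total.hom (specResidueField v))).baseChange (𝓨.geomReductionMap x).left).hat.mulN N) ∧
      -- (K3-gen) [★ (ν8R) (v-b) through ★ organ #2's `E`] KILL along a flat `𝒦 ↪ 𝒜_x̃` over the valuation ring `R = 𝒪_Ω̄` of the point `x` (`x̃` the `R`-point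
      -- extending `x`): if `𝒦_η`, read in `(𝒜_η)_x` through the three-piece isomorphism of ★ (d5), is killed by the LEG `q` (target `B`), then `𝒦_s`, read in `(𝒜_s)_x̄`, is killed by `q̄`
      (∀ (𝒦 : Over (Spec (.of (closureValuationSubring (v.adicCompletion K))))) (incl : 𝒦 ⟶ (𝒜.baseChange (extendPoint (closureValuationSubring (v.adicCompletion K)) (toClosureValuationSubring v) 𝓨.total (𝓨.modelPointsEquiv.symm x)).left).X) [Flat 𝒦.hom],
        ((Over.pullback (specFractionFieldι (closureValuationSubring (v.adicCompletion K)) (toClosureValuationSubring v)).left).map incl ≫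
            (𝒜.fibreBaseChangeIso (𝓨.genericIso'.inv.left ≫ pullback.fst 𝓨.total.hom (specGenericPoint (valuationSubringAtPrime K v) K)) x.left ≪≫ 𝒜.fibreCongrPtIso (𝓨.left_specFractionFieldι_comp_extendPoint_modelPointsEquiv_symm x).symm ≪≫ (𝒜.fibreBaseChangeIso (extendPoint (closureValuationSubring (v.adicCompletion K)) (toClosureValuationSubring v) 𝓨.total (𝓨.modelPointsEquiv.symm x)).left (specFractionFieldι (closureValuationSubring (v.adicCompletion K)) (toClosureValuationSubring v)).left).symm).inv.hom.hom.hom) ≫ q = 1 →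
        ((Over.pullback ((geomClosedPointIsoSpecResidueField v).inv.left ≫ (specRingHomι (closureValuationSubring (v.adicCompletion K)) (toClosureValuationSubring v) (IsLocalRing.residue (closureValuationSubring (v.adicCompletion K)))).left)).map incl ≫
            (𝒜.fibreBaseChangeIso (pullback.fst 𝓨.total.hom (specResidueField v)) (𝓨.geomReductionMap x).left ≪≫ 𝒜.fibreCongrPtIso ((𝓨.left_geomReductionMap_comp_fst x).trans (Category.assoc _ _ _).symm) ≪≫ (𝒜.fibreBaseChangeIso (extendPoint (closureValuationSubring (v.adicCompletion K)) (toClosureValuationSubring v) 𝓨.total (𝓨.modelPointsEquiv.symm x)).left ((geomClosedPointIsoSpecResidueField v).inv.left ≫ (specRingHomι (closureValuationSubring (v.adicCompletion K)) (toClosureValuationSubring v) (IsLocalRing.residue (closureValuationSubring (v.adicCompletion K)))).left)).symm).inv.hom.hom.hom) ≫ qbar = 1) ∧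
      -- (K2-gen) [★ (ν8k-b) (v-b), `Ω̄`-points premiss] for every ideal `𝔞` of `𝒪`: if every `Ω̄`-point of `𝒜_x` killed by `q` is killed by `ι(𝔞)`, then every `T`-valued point of
      -- `𝒜_{x̄}` killed by `q̄` is killed by `ι(𝔞)` (upstairs upgrade to `T`-points: `q′ = q ≫ E⁻¹` is an isogeny in characteristic `0`, ★ `EtaleKernelDecidedOnPoints`)
      (∀ 𝔞 : Ideal O,
        (∀ Pt : ((𝒜.baseChange (𝓨.genericIso'.inv.left ≫ pullback.fst 𝓨.total.hom (specGenericPoint (valuationSubringAtPrime K v) K))).baseChange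
            x.left).toAffine.toAbelianVariety.Points (AlgebraicClosure (v.adicCompletion K)),
          (AlgPoints.map q Pt : B.toAffine.toAbelianVariety.Points (AlgebraicClosure (v.adicCompletion K))) = 1 →
            ∀ r ∈ 𝔞, (AlgPoints.map (((act.baseChange (𝓨.genericIso'.inv.left ≫ pullback.fst 𝓨.total.hom (specGenericPoint (valuationSubringAtPrime K v) K))).baseChange x.left).i r) Pt :
              ((𝒜.baseChange (𝓨.genericIso'.inv.left ≫ pullback.fst 𝓨.total.hom (specGenericPoint (valuationSubringAtPrime K v) K))).baseChange
                x.left).toAffine.toAbelianVariety.Points (AlgebraicClosure (v.adicCompletion K))) = 1) →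
        ∀ ⦃T : Over (Spec (.of (geomResidueField v)))⦄ (z : T ⟶ ((𝒜.baseChange (pullback.fst 𝓨.total.hom (specResidueField v))).baseChange (𝓨.geomReductionMap x).left).X),
          z ≫ qbar = 1 → ∀ r ∈ 𝔞, z ≫ ((act.baseChange (pullback.fst 𝓨.total.hom (specResidueField v))).baseChange (𝓨.geomReductionMap x).left).i r = 1) ∧
      -- (IMG-gen) [★ image head (v-c), A-p06 (g36)] IMAGE ∕ FACTORISATION in ROOF currency along a flat `𝒦 ↪ 𝒜_x̃` INTO `c̄(𝒵)` for a model subscheme `ζ : 𝒵 → 𝒜_x̃″` (`x̃″` the `R`-point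
      -- extending `x″`) with `ζ ≫ (ψ_P ×_𝓨 x̃″)` a CLOSED immersion: if `incl_η ≫ e⁻¹ ≫ q` factors through `ζ_η ≫ e⁻¹ ≫ c` (LEGS `q`, `c`, target `B`), then `incl_s̄ ≫ e⁻¹ ≫ q̄`
      -- factors through `ζ_s̄ ≫ e⁻¹ ≫ c̄_{x̄″}` (`c̄_{x̄″} = ψ_P` at `x̄″`); three-piece isomorphisms `e` of `𝒜` at `x` and at `x″` explicit, as in (K3-gen)
      (∀ (𝒦 : Over (Spec (.of (closureValuationSubring (v.adicCompletion K))))) (incl : 𝒦 ⟶ (𝒜.baseChange (extendPoint (closureValuationSubring (v.adicCompletion K)) (toClosureValuationSubring v) 𝓨.total (𝓨.modelPointsEquiv.symm x)).left).X) [Flat 𝒦.hom]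
        (𝒵 : Over (Spec (.of (closureValuationSubring (v.adicCompletion K))))) (ζ : 𝒵 ⟶ (𝒜.baseChange (extendPoint (closureValuationSubring (v.adicCompletion K)) (toClosureValuationSubring v) 𝓨.total (𝓨.modelPointsEquiv.symm x'')).left).X) [IsClosedImmersion (ζ ≫ baseChangeHom (serreTranslate act E' hE' P) (extendPoint (closureValuationSubring (v.adicCompletion K)) (toClosureValuationSubring v) 𝓨.total (𝓨.modelPointsEquiv.symm x'')).left).left],
        (∃ m : (Over.pullback (specFractionFieldι (closureValuationSubring (v.adicCompletion K)) (toClosureValuationSubring v)).left).obj 𝒦 ⟶ (Over.pullback (specFractionFieldι (closureValuationSubring (v.adicCompletion K)) (toClosureValuationSubring v)).left).obj 𝒵,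
          m ≫ (((Over.pullback (specFractionFieldι (closureValuationSubring (v.adicCompletion K)) (toClosureValuationSubring v)).left).map ζ ≫ (𝒜.fibreBaseChangeIso (𝓨.genericIso'.inv.left ≫ pullback.fst 𝓨.total.hom (specGenericPoint (valuationSubringAtPrime K v) K)) x''.left ≪≫ 𝒜.fibreCongrPtIso (𝓨.left_specFractionFieldι_comp_extendPoint_modelPointsEquiv_symm x'').symm ≪≫ (𝒜.fibreBaseChangeIso (extendPoint (closureValuationSubring (v.adicCompletion K)) (toClosureValuationSubring v) 𝓨.total (𝓨.modelPointsEquiv.symm x'')).left (specFractionFieldι (closureValuationSubring (v.adicCompletion K)) (toClosureValuationSubring v)).left).symm).inv.hom.hom.hom) ≫ c) =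
            ((Over.pullback (specFractionFieldι (closureValuationSubring (v.adicCompletion K)) (toClosureValuationSubring v)).left).map incl ≫ (𝒜.fibreBaseChangeIso (𝓨.genericIso'.inv.left ≫ pullback.fst 𝓨.total.hom (specGenericPoint (valuationSubringAtPrime K v) K)) x.left ≪≫ 𝒜.fibreCongrPtIso (𝓨.left_specFractionFieldι_comp_extendPoint_modelPointsEquiv_symm x).symm ≪≫ (𝒜.fibreBaseChangeIso (extendPoint (closureValuationSubring (v.adicCompletion K)) (toClosureValuationSubring v) 𝓨.total (𝓨.modelPointsEquiv.symm x)).left (specFractionFieldι (closureValuationSubring (v.adicCompletion K)) (toClosureValuationSubring v)).left).symm).inv.hom.hom.hom) ≫ q) →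
        ∃ m : (Over.pullback ((geomClosedPointIsoSpecResidueField v).inv.left ≫ (specRingHomι (closureValuationSubring (v.adicCompletion K)) (toClosureValuationSubring v) (IsLocalRing.residue (closureValuationSubring (v.adicCompletion K)))).left)).obj 𝒦 ⟶ (Over.pullback ((geomClosedPointIsoSpecResidueField v).inv.left ≫ (specRingHomι (closureValuationSubring (v.adicCompletion K)) (toClosureValuationSubring v) (IsLocalRing.residue (closureValuationSubring (v.adicCompletion K)))).left)).obj 𝒵,
          m ≫ (((Over.pullback ((geomClosedPointIsoSpecResidueField v).inv.left ≫ (specRingHomι (closureValuationSubring (v.adicCompletion K)) (toClosureValuationSubring v) (IsLocalRing.residue (closureValuationSubring (v.adicCompletion K)))).left)).map ζ ≫ (𝒜.fibreBaseChangeIso (pullback.fst 𝓨.total.hom (specResidueField v)) (𝓨.geomReductionMap x'').left ≪≫ 𝒜.fibreCongrPtIso ((𝓨.left_geomReductionMap_comp_fst x'').trans (Category.assoc _ _ _).symm) ≪≫ (𝒜.fibreBaseChangeIso (extendPoint (closureValuationSubring (v.adicCompletion K)) (toClosureValuationSubring v) 𝓨.total (𝓨.modelPointsEquiv.symm x'')).left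 ((geomClosedPointIsoSpecResidueField v).inv.left ≫ (specRingHomι (closureValuationSubring (v.adicCompletion K)) (toClosureValuationSubring v) (IsLocalRing.residue (closureValuationSubring (v.adicCompletion K)))).left)).symm).inv.hom.hom.hom) ≫ baseChangeHom (baseChangeHom (serreTranslate act E' hE' P) (pullback.fst 𝓨.total.hom (specResidueField v))) (𝓨.geomReductionMap x'').left) =
            ((Over.pullback ((geomClosedPointIsoSpecResidueField v).inv.left ≫ (specRingHomι (closureValuationSubring (v.adicCompletion K)) (toClosureValuationSubring v) (IsLocalRing.residue (closureValuationSubring (v.adicCompletion K)))).left)).map incl ≫ (𝒜.fibreBaseChangeIso (pullback.fst 𝓨.total.hom (specResidueField v)) (𝓨.geomReductionMap x).left ≪≫ 𝒜.fibreCongrPtIso ((𝓨.left_geomReductionMap_comp_fst x).trans (Category.assoc _ _ _).symm) ≪≫ (𝒜.fibreBaseChangeIso (extendPoint (closureValuationSubring (v.adicCompletion K)) (toClosureValuationSubring v) 𝓨.total (𝓨.modelPointsEquiv.symm x)).left ((geomClosedPointIsoSpecResidueField v).inv.left ≫ (specRingHomι (closureValuationSubring (v.adicCompletion K)) (toClosureValuationSubring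 v) (IsLocalRing.residue (closureValuationSubring (v.adicCompletion K)))).left)).symm).inv.hom.hom.hom) ≫ qbar) := by
  haveI := isMonHom_serreTranslate act E' hE' P
  haveI := isMonHom_serreTranslateInv act E' hE' Q
  haveI := pol.isMonHom
  haveI : CharZero (v.adicCompletion K) := charZero_of_injective_algebraMap (algebraMap K (v.adicCompletion K)).injective
  haveI : IsLocallyNoetherian (specOver K (AlgebraicClosure (v.adicCompletion K))).left :=
    inferInstanceAs (IsLocallyNoetherian (Spec (.of (AlgebraicClosure (v.adicCompletion K)))))
  haveI : IsReduced (specOver K (AlgebraicClosure (v.adicCompletion K))).left :=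
    inferInstanceAs (IsReduced (Spec (.of (AlgebraicClosure (v.adicCompletion K)))))
  haveI : IsLocallyNoetherian (specOver v.asIdeal.ResidueField (geomResidueField v)).left :=
    inferInstanceAs (IsLocallyNoetherian (Spec (.of (geomResidueField v))))
  haveI : IsReduced (specOver v.asIdeal.ResidueField (geomResidueField v)).left :=
    inferInstanceAs (IsReduced (Spec (.of (geomResidueField v))))
  -- STEP 1 (★ organ #2): the middle is the Serre-family fibre, `E : 𝒞_{x″} ≅ B` with `c̄ ≫ E = c`
  obtain ⟨E, hE, hEmon, hEinv, -⟩ := exists_iso_coverLeg_comp_eq_of_forall_points_of_charZero (𝓨.genericIso'.inv.left ≫ pullback.fst 𝓨.total.hom (specGenericPoint (valuationSubringAtPrime K v) K)) x''.left act E' hE' P Q c hN hP hQ hQP hPQ h𝔭 hker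
  haveI := hEmon
  haveI := hEinv
  -- the cover leg and the cover at the generic iterated base change (★ organ #1 ∕ #2)
  haveI hψmon := isMonHom_coverLeg (𝓨.genericIso'.inv.left ≫ pullback.fst 𝓨.total.hom (specGenericPoint (valuationSubringAtPrime K v) K)) x''.left act E' hE' P
  haveI := flat_coverLeg_left (𝓨.genericIso'.inv.left ≫ pullback.fst 𝓨.total.hom (specGenericPoint (valuationSubringAtPrime K v) K)) x''.left act E' hE' P Q hN hP hQ hQP hPQ
  haveI := surjective_coverLeg_left (𝓨.genericIso'.inv.left ≫ pullback.fst 𝓨.total.hom (specGenericPoint (valuationSubringAtPrime K v) K)) x''.left act E' hE' P Q hN hP hQ hQP hPQ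
  haveI := isFinite_coverLeg_left (𝓨.genericIso'.inv.left ≫ pullback.fst 𝓨.total.hom (specGenericPoint (valuationSubringAtPrime K v) K)) x''.left act E' hE' P Q hN hP hQ hQP hPQ
  haveI : QuasiCompact (baseChangeHom (baseChangeHom (serreTranslate act E' hE' P) (𝓨.genericIso'.inv.left ≫ pullback.fst 𝓨.total.hom (specGenericPoint (valuationSubringAtPrime K v) K))) x''.left).left := inferInstance
  haveI : IsMonHom (baseChangeHom (baseChangeHom (serreTranslateInv act E' hE' Q) (𝓨.genericIso'.inv.left ≫ pullback.fst 𝓨.total.hom (specGenericPoint (valuationSubringAtPrime K v) K))) x''.left) :=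
    (haveI := isMonHom_baseChangeHom (serreTranslateInv act E' hE' Q) (𝓨.genericIso'.inv.left ≫ pullback.fst 𝓨.total.hom (specGenericPoint (valuationSubringAtPrime K v) K)); isMonHom_baseChangeHom _ x''.left)
  -- STEP 2: `q′ := q ≫ E⁻¹`, finite surjective
  haveI : IsFinite (q ≫ E.inv).left := isFinite_retarget_left q E
  haveI : Surjective (q ≫ E.inv).left := surjective_retarget_left q E
  -- STEP 3 (★ `exists_specialFibre_hom_reduction_kerRows_image`): reduce `q′` ONCE, keeping (iv-h), the model KILL (v-b-model), the ideal bound (K2) and the factorisation (v-c)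
  obtain ⟨qbar, hqmon, h1, h2, h3, -, h5, h6, -, h8, h9⟩ := exists_specialFibre_hom_reduction_kerRows_image 𝓨 𝒜 (serreTensor act E' hE') x x'' (q ≫ E.inv) act
  haveI := hqmon
  refine ⟨qbar, hqmon, h1 inferInstance inferInstance, ?_, ?_, ?_, ?_, ?_, ?_⟩
  · -- (r4₀-q): common intertwiners re-target (★ organ #2) then transfer (★ (ν8)(ii))
    intro a
    haveI := act.isMonHom a
    haveI := (serreAction act E' hE').isMonHom a
    obtain ⟨b, hqb, hcb⟩ := hb a
    exact h2 (act.i a) ((serreAction act E' hE').i a)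
      (i_comp_retarget_of_common_intertwiner q c (baseChangeHom (baseChangeHom (serreTranslate act E' hE' P) (𝓨.genericIso'.inv.left ≫ pullback.fst 𝓨.total.hom (specGenericPoint (valuationSubringAtPrime K v) K))) x''.left) E hE hqb hcb
        (i_comp_coverLeg (𝓨.genericIso'.inv.left ≫ pullback.fst 𝓨.total.hom (specGenericPoint (valuationSubringAtPrime K v) K)) x''.left act E' hE' P hP a))
  · -- (r5₀-q): point identities re-target (★ organ #2) then transfer (★ (ν8)(iii)) — sections edition
    intro i
    have hup : AlgPoints.map (q ≫ E.inv) ((𝒜.baseChange (𝓨.genericIso'.inv.left ≫ pullback.fst 𝓨.total.hom (specGenericPoint (valuationSubringAtPrime K v) K))).restrictPt x.left (𝒜.sectionBaseChange (𝓨.genericIso'.inv.left ≫ pullback.fst 𝓨.total.hom (specGenericPoint (valuationSubringAtPrime K v) K)) (τ i))) =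
        ((serreTensor act E' hE').baseChange (𝓨.genericIso'.inv.left ≫ pullback.fst 𝓨.total.hom (specGenericPoint (valuationSubringAtPrime K v) K))).restrictPt x''.left
          ((serreTensor act E' hE').sectionBaseChange (𝓨.genericIso'.inv.left ≫ pullback.fst 𝓨.total.hom (specGenericPoint (valuationSubringAtPrime K v) K)) (τ i ≫ serreTranslate act E' hE' P)) := by
      rw [map_retarget_eq_map q c (baseChangeHom (baseChangeHom (serreTranslate act E' hE' P) (𝓨.genericIso'.inv.left ≫ pullback.fst 𝓨.total.hom (specGenericPoint (valuationSubringAtPrime K v) K))) x''.left) E hE _ _ (hlev i),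
        sectionBaseChange_comp, ← map_fibreHom_restrictPt x''.left (baseChangeHom (serreTranslate act E' hE' P) (𝓨.genericIso'.inv.left ≫ pullback.fst 𝓨.total.hom (specGenericPoint (valuationSubringAtPrime K v) K)))]
      rfl
    exact h3 (τ i) (τ i ≫ serreTranslate act E' hE' P) hup
  · -- (r3₀-q) THROUGH `𝒜`: upstairs multiply (§1) → (iv-h) → downstairs divide (§1)
    intro DBs hDBs lamBs _ hc3s
    -- unit pins of the base-changed dual pairs of `𝒜`
    have hDηx := DualPair.nonempty_unitHatSlice_baseChange_iso (g := x.left) _ (DualPair.nonempty_unitHatSlice_baseChange_iso (g := (𝓨.genericIso'.inv.left ≫ pullback.fst 𝓨.total.hom (specGenericPoint (valuationSubringAtPrime K v) K))) D hD)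
    have hDη'' := DualPair.nonempty_unitHatSlice_baseChange_iso (g := x''.left) _ (DualPair.nonempty_unitHatSlice_baseChange_iso (g := (𝓨.genericIso'.inv.left ≫ pullback.fst 𝓨.total.hom (specGenericPoint (valuationSubringAtPrime K v) K))) D hD)
    have hDs := DualPair.nonempty_unitHatSlice_baseChange_iso (g := (𝓨.geomReductionMap x).left) _ (DualPair.nonempty_unitHatSlice_baseChange_iso (g := (pullback.fst 𝓨.total.hom (specResidueField v))) D hD)
    have hDs'' := DualPair.nonempty_unitHatSlice_baseChange_iso (g := (𝓨.geomReductionMap x'').left) _ (DualPair.nonempty_unitHatSlice_baseChange_iso (g := (pullback.fst 𝓨.total.hom (specResidueField v))) D hD)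
    haveI := ((pol.baseChange (𝓨.genericIso'.inv.left ≫ pullback.fst 𝓨.total.hom (specGenericPoint (valuationSubringAtPrime K v) K))).baseChange x.left).isMonHom
    haveI := ((pol.baseChange (𝓨.genericIso'.inv.left ≫ pullback.fst 𝓨.total.hom (specGenericPoint (valuationSubringAtPrime K v) K))).baseChange x''.left).isMonHom
    haveI := ((pol.baseChange (pullback.fst 𝓨.total.hom (specResidueField v))).baseChange (𝓨.geomReductionMap x).left).isMonHom
    haveI := ((pol.baseChange (pullback.fst 𝓨.total.hom (specResidueField v))).baseChange (𝓨.geomReductionMap x'').left).isMonHom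
    haveI : IsCommMonObj B.X := B.isCommMonObj_of_isReduced_base
    haveI : IsMonHom (B.mulN N) := B.isMonHom_mulN N
    -- `c` is fppf (it is `c̄_η ≫ E`)
    haveI : Flat c.left := by rw [← hE]; exact flat_retarget_left (baseChangeHom (baseChangeHom (serreTranslate act E' hE' P) (𝓨.genericIso'.inv.left ≫ pullback.fst 𝓨.total.hom (specGenericPoint (valuationSubringAtPrime K v) K))) x''.left) E.symm
    haveI : IsFinite c.left := by
      rw [← hE]; exact isFinite_retarget_left (baseChangeHom (baseChangeHom (serreTranslate act E' hE' P) (𝓨.genericIso'.inv.left ≫ pullback.fst 𝓨.total.hom (specGenericPoint (valuationSubringAtPrime K v) K))) x''.left) E.symm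
    haveI : QuasiCompact c.left := inferInstance
    -- UPSTAIRS: `d := E⁻¹ ≫ ψ′_{x″}` is a quasi-inverse of `c`: `c ≫ d = [N]`, `d ≫ c = [N]`, hence `c^∨ ≫ d^∨ = [N]`
    have hcd : c ≫ (E.inv ≫ baseChangeHom (baseChangeHom (serreTranslateInv act E' hE' Q) (𝓨.genericIso'.inv.left ≫ pullback.fst 𝓨.total.hom (specGenericPoint (valuationSubringAtPrime K v) K))) x''.left) =
        (𝟙 ((𝒜.baseChange (𝓨.genericIso'.inv.left ≫ pullback.fst 𝓨.total.hom (specGenericPoint (valuationSubringAtPrime K v) K))).baseChange x''.left).X) ^ N := by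
      rw [← hE, Category.assoc, E.hom_inv_id_assoc]
      exact baseChangeHom_comp_eq_pow_id_of_comp_eq_pow_id x''.left _ _
        (baseChangeHom_comp_eq_pow_id_of_comp_eq_pow_id (𝓨.genericIso'.inv.left ≫ pullback.fst 𝓨.total.hom (specGenericPoint (valuationSubringAtPrime K v) K)) _ _ (serreTranslate_comp_serreTranslateInv act E' hE' P Q hP hQ hQP))
    have hdc : (E.inv ≫ baseChangeHom (baseChangeHom (serreTranslateInv act E' hE' Q) (𝓨.genericIso'.inv.left ≫ pullback.fst 𝓨.total.hom (specGenericPoint (valuationSubringAtPrime K v) K))) x''.left) ≫ c = B.mulN N := by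
      rw [← hE, Category.assoc, ← Category.assoc (baseChangeHom (baseChangeHom (serreTranslateInv act E' hE' Q) (𝓨.genericIso'.inv.left ≫ pullback.fst 𝓨.total.hom (specGenericPoint (valuationSubringAtPrime K v) K))) x''.left),
        coverLegInv_comp_coverLeg (𝓨.genericIso'.inv.left ≫ pullback.fst 𝓨.total.hom (specGenericPoint (valuationSubringAtPrime K v) K)) x''.left act E' hE' P Q hP hQ hPQ, ← Category.assoc, comp_pow_id_eq_pow_id_comp B E.inv N,
        Category.assoc, E.inv_hom_id, Category.comp_id, mulN_def]
    have hχ : DualPair.dualIsogenyOver c ((D.baseChange (𝓨.genericIso'.inv.left ≫ pullback.fst 𝓨.total.hom (specGenericPoint (valuationSubringAtPrime K v) K))).baseChange x''.left) DB ≫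
        DualPair.dualIsogenyOver (E.inv ≫ baseChangeHom (baseChangeHom (serreTranslateInv act E' hE' Q) (𝓨.genericIso'.inv.left ≫ pullback.fst 𝓨.total.hom (specGenericPoint (valuationSubringAtPrime K v) K))) x''.left) DB ((D.baseChange (𝓨.genericIso'.inv.left ≫ pullback.fst 𝓨.total.hom (specGenericPoint (valuationSubringAtPrime K v) K))).baseChange x''.left) =
        (𝟙 DB.hat.X) ^ N := by
      rw [← DualPair.dualIsogenyOver_comp _ _ DB ((D.baseChange (𝓨.genericIso'.inv.left ≫ pullback.fst 𝓨.total.hom (specGenericPoint (valuationSubringAtPrime K v) K))).baseChange x''.left) DB,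
        DualPair.dualIsogenyOver_congr DB DB (ψ₂ := B.mulN N) (h₂ := inferInstance) hdc, DualPair.dualIsogenyOver_mulN DB hDB N, mulN_def]
    have hup := comp_comp_lam_comp_dualIsogenyOver_of_quasiInverse ((D.baseChange (𝓨.genericIso'.inv.left ≫ pullback.fst 𝓨.total.hom (specGenericPoint (valuationSubringAtPrime K v) K))).baseChange x.left) ((D.baseChange (𝓨.genericIso'.inv.left ≫ pullback.fst 𝓨.total.hom (specGenericPoint (valuationSubringAtPrime K v) K))).baseChange x''.left) DB hDηx hDη'' hDB
      c (E.inv ≫ baseChangeHom (baseChangeHom (serreTranslateInv act E' hE' Q) (𝓨.genericIso'.inv.left ≫ pullback.fst 𝓨.total.hom (specGenericPoint (valuationSubringAtPrime K v) K))) x''.left)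
      ((pol.baseChange (𝓨.genericIso'.inv.left ≫ pullback.fst 𝓨.total.hom (specGenericPoint (valuationSubringAtPrime K v) K))).baseChange x.left).lam ((pol.baseChange (𝓨.genericIso'.inv.left ≫ pullback.fst 𝓨.total.hom (specGenericPoint (valuationSubringAtPrime K v) K))).baseChange x''.left).lam lamB hN hcd hχ hc3 q hq3
      ((q ≫ E.inv) ≫ baseChangeHom (baseChangeHom (serreTranslateInv act E' hE' Q) (𝓨.genericIso'.inv.left ≫ pullback.fst 𝓨.total.hom (specGenericPoint (valuationSubringAtPrime K v) K))) x''.left) (Category.assoc _ _ _)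
    -- TRANSFER (★ (ν8h) (iv-h)) with `ℰ := 𝒜`, `h := ψ′`
    haveI : IsMonHom (baseChangeHom (baseChangeHom (serreTranslateInv act E' hE' Q) (pullback.fst 𝓨.total.hom (specResidueField v))) (𝓨.geomReductionMap x'').left) :=
      (haveI := isMonHom_baseChangeHom (serreTranslateInv act E' hE' Q) (pullback.fst 𝓨.total.hom (specResidueField v)); isMonHom_baseChangeHom _ (𝓨.geomReductionMap x'').left)
    have hdown := h5 𝒜 (serreTranslateInv act E' hE' Q) ((q ≫ E.inv) ≫ baseChangeHom (baseChangeHom (serreTranslateInv act E' hE' Q) (𝓨.genericIso'.inv.left ≫ pullback.fst 𝓨.total.hom (specGenericPoint (valuationSubringAtPrime K v) K))) x''.left) rfl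
      D pol D pol (N * N) hup (qbar ≫ baseChangeHom (baseChangeHom (serreTranslateInv act E' hE' Q) (pullback.fst 𝓨.total.hom (specResidueField v))) (𝓨.geomReductionMap x'').left) rfl
    -- DOWNSTAIRS: `ψ′_{x̄″}` is a quasi-inverse of the cover leg `c̄` (★ organ #1 ∕ #2), divide by `[N]`
    haveI := isMonHom_coverLeg (pullback.fst 𝓨.total.hom (specResidueField v)) (𝓨.geomReductionMap x'').left act E' hE' P
    haveI := flat_coverLeg_left (pullback.fst 𝓨.total.hom (specResidueField v)) (𝓨.geomReductionMap x'').left act E' hE' P Q hN hP hQ hQP hPQ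
    haveI := surjective_coverLeg_left (pullback.fst 𝓨.total.hom (specResidueField v)) (𝓨.geomReductionMap x'').left act E' hE' P Q hN hP hQ hQP hPQ
    haveI := isFinite_coverLeg_left (pullback.fst 𝓨.total.hom (specResidueField v)) (𝓨.geomReductionMap x'').left act E' hE' P Q hN hP hQ hQP hPQ
    haveI : QuasiCompact (baseChangeHom (baseChangeHom (serreTranslate act E' hE' P) (pullback.fst 𝓨.total.hom (specResidueField v))) (𝓨.geomReductionMap x'').left).left := inferInstance
    have hcds : baseChangeHom (baseChangeHom (serreTranslate act E' hE' P) (pullback.fst 𝓨.total.hom (specResidueField v))) (𝓨.geomReductionMap x'').left ≫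
        baseChangeHom (baseChangeHom (serreTranslateInv act E' hE' Q) (pullback.fst 𝓨.total.hom (specResidueField v))) (𝓨.geomReductionMap x'').left =
        (𝟙 ((𝒜.baseChange (pullback.fst 𝓨.total.hom (specResidueField v))).baseChange (𝓨.geomReductionMap x'').left).X) ^ N :=
      baseChangeHom_comp_eq_pow_id_of_comp_eq_pow_id (𝓨.geomReductionMap x'').left _ _
        (baseChangeHom_comp_eq_pow_id_of_comp_eq_pow_id (pullback.fst 𝓨.total.hom (specResidueField v)) _ _ (serreTranslate_comp_serreTranslateInv act E' hE' P Q hP hQ hQP))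
    have hχs := dualIsogenyOver_coverLeg_comp_eq_pow_id (pullback.fst 𝓨.total.hom (specResidueField v)) (𝓨.geomReductionMap x'').left act E' hE' P Q hP hQ hPQ ((D.baseChange (pullback.fst 𝓨.total.hom (specResidueField v))).baseChange (𝓨.geomReductionMap x'').left) DBs hDBs
    exact comp_lam_comp_dualIsogenyOver_of_postcomp_of_quasiInverse ((D.baseChange (pullback.fst 𝓨.total.hom (specResidueField v))).baseChange (𝓨.geomReductionMap x).left) ((D.baseChange (pullback.fst 𝓨.total.hom (specResidueField v))).baseChange (𝓨.geomReductionMap x'').left) DBs hDs hDs'' hDBs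
      (baseChangeHom (baseChangeHom (serreTranslate act E' hE' P) (pullback.fst 𝓨.total.hom (specResidueField v))) (𝓨.geomReductionMap x'').left) (baseChangeHom (baseChangeHom (serreTranslateInv act E' hE' Q) (pullback.fst 𝓨.total.hom (specResidueField v))) (𝓨.geomReductionMap x'').left)
      ((pol.baseChange (pullback.fst 𝓨.total.hom (specResidueField v))).baseChange (𝓨.geomReductionMap x).left).lam ((pol.baseChange (pullback.fst 𝓨.total.hom (specResidueField v))).baseChange (𝓨.geomReductionMap x'').left).lam lamBs hN hcds hχs hc3s
      qbar (qbar ≫ baseChangeHom (baseChangeHom (serreTranslateInv act E' hE' Q) (pullback.fst 𝓨.total.hom (specResidueField v))) (𝓨.geomReductionMap x'').left) rfl hdown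
  · -- (K3-gen): the model KILL row of the head, for `q′ = q ≫ E⁻¹`; `q` kills ⇒ `q′` kills
    intro 𝒦 incl _ hk
    exact h6 𝒦 incl (by simpa only [Category.assoc, MonObj.one_comp] using congrArg (· ≫ E.inv) hk)
  · -- (K2-gen): the ideal-bound row of the head at `𝔞`, its `T`-points premiss for `q′` obtained from the `Ω̄`-points premiss for `q` (char 0, `q′` an isogeny)
    intro 𝔞 hpts T z hz
    refine h8 inferInstance inferInstance 𝔞 (fun T' t ht r hr => ?_) z hz
    refine comp_eq_one_of_forall_points_of_charZero (q ≫ E.inv)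
      (((act.baseChange (𝓨.genericIso'.inv.left ≫ pullback.fst 𝓨.total.hom (specGenericPoint (valuationSubringAtPrime K v) K))).baseChange x.left).i r) (fun Pt hP => ?_) t ht
    -- `q′(Pt) = 1 ⇒ q(Pt) = 1` (`E` an isomorphism of group schemes)
    have hq1 : (AlgPoints.map q Pt : B.toAffine.toAbelianVariety.Points (AlgebraicClosure (v.adicCompletion K))) = 1 := by
      have e1 : AlgPoints.map q Pt = AlgPoints.map E.hom (AlgPoints.map (q ≫ E.inv) Pt) := by
        rw [← AlgPoints.map_comp_apply, Category.assoc, E.inv_hom_id, Category.comp_id]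
      rw [e1, hP]
      exact MonObj.one_comp E.hom
    exact hpts Pt hq1 r hr
  · -- (IMG-gen): the head's (v-c) for `q′ = q ≫ E⁻¹` at the closed `ζ ≫ c̄_R : 𝒵 → 𝒞_x̃″`; §0 moves `c̄_R` through the three-piece isomorphisms (`ψ_P` is a model
    -- homomorphism), and upstairs `c̄_{x″} = c ≫ E⁻¹` (★ organ #2: `c̄_{x″} ≫ E = c`)
    intro 𝒦 incl _ 𝒵 ζ _ hfac
    obtain ⟨m, hm⟩ := hfac
    have hcE : baseChangeHom (baseChangeHom (serreTranslate act E' hE' P) (𝓨.genericIso'.inv.left ≫ pullback.fst 𝓨.total.hom (specGenericPoint (valuationSubringAtPrime K v) K))) x''.left = c ≫ E.inv := by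
      rw [← hE, Category.assoc, E.hom_inv_id, Category.comp_id]
    have natη := pullback_map_baseChangeHom_comp_threePiece_inv (𝒜 := 𝒜) (𝒞 := serreTensor act E' hE') (serreTranslate act E' hE' P) (𝓨.genericIso'.inv.left ≫ pullback.fst 𝓨.total.hom (specGenericPoint (valuationSubringAtPrime K v) K)) x''.left (extendPoint (closureValuationSubring (v.adicCompletion K)) (toClosureValuationSubring v) 𝓨.total (𝓨.modelPointsEquiv.symm x'')).left
      (specFractionFieldι (closureValuationSubring (v.adicCompletion K)) (toClosureValuationSubring v)).left (𝓨.left_specFractionFieldι_comp_extendPoint_modelPointsEquiv_symm x'').symm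
    have nats := pullback_map_baseChangeHom_comp_threePiece_inv (𝒜 := 𝒜) (𝒞 := serreTensor act E' hE') (serreTranslate act E' hE' P) (pullback.fst 𝓨.total.hom (specResidueField v)) (𝓨.geomReductionMap x'').left (extendPoint (closureValuationSubring (v.adicCompletion K)) (toClosureValuationSubring v) 𝓨.total (𝓨.modelPointsEquiv.symm x'')).left
      ((geomClosedPointIsoSpecResidueField v).inv.left ≫ (specRingHomι (closureValuationSubring (v.adicCompletion K)) (toClosureValuationSubring v) (IsLocalRing.residue (closureValuationSubring (v.adicCompletion K)))).left) ((𝓨.left_geomReductionMap_comp_fst x'').trans (Category.assoc _ _ _).symm)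
    obtain ⟨m', hm'⟩ := h9 𝒦 incl 𝒵 (ζ ≫ baseChangeHom (serreTranslate act E' hE' P) (extendPoint (closureValuationSubring (v.adicCompletion K)) (toClosureValuationSubring v) 𝓨.total (𝓨.modelPointsEquiv.symm x'')).left) ⟨m, by
      have h' := congrArg (· ≫ E.inv) hm
      simp only [Functor.map_comp, Category.assoc] at h' ⊢
      rw [natη, hcE]
      simpa only [Category.assoc] using h'⟩
    simp only [Functor.map_comp, Category.assoc] at hm'
    rw [nats] at hm'
    exact ⟨m', by simpa only [Category.assoc] using hm'⟩

end Head

end AbelianSchemeOver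

end Literature.AlgebraicGeometry.AbelianSchemes

end
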